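import Summits.CriticalPhenomena.PercolationContinuityZ3.Theorems.PercNearOneGluingNoHeavyLowerTailSahiGridPatternLiteralTwoGood
import Summits.CriticalPhenomena.PercolationContinuityZ3.Theorems.PercNearOneGluingNoHeavyLowerTailSahiGridPatternDiagCert
import Summits.CriticalPhenomena.PercolationContinuityZ3.Theorems.PercNearOneGluingNoHeavyLowerTailSahiGridPatternKleitman

/-!
# `NoHeavyLowerTail` (crux stmt-CriticalPhenomena-4575), Sahi programme P1: **DIAGONAL CERTIFICATES PROPAGATE THROUGH THE LITERAL-AND STEP** —
# if `d` certifies `V ⊆ [3]^k` then `d' = (0, 2d, 2d)` certifies `{x₀ ≥ 1} ∧ V ⊆ [3]^{1+k}` (every `k`), hence the glued set is good in EVERY dimension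

Support file (Sahi cell, seat `prim-sahi-p1`, generation 28; `--supports stmt-CriticalPhenomena-4575`).  Pure proofs, no definitions, no `sorry`,
standard axioms.  Vocabulary of `…SahiGridPattern{,CellForm,SliceForm,RectCert,DiagCert}` (`Pd`, `sStarD`, `glue`, `sect`, `cellOf`, `freeOf`, `ind`,
`TotDist`, `thirdPt`, `lamU`, `thetaVal`, `nuCount`, `cylSet`); three small lemmas of `…SahiGridPatternCylinderOneAxis` (same generation) are repeated
privately because that module was not yet built on the farm when this file was checked.

THE MATHEMATICS.  A DIAGONAL CERTIFICATE of an up-set `U ⊆ [3]^k` (`…SahiGridPatternDiagCert`) is `d : [3]^k → ℤ`, `d ≥ 0`, with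
(T) `Σ_{q∈W} d(q) ≤ Σ_{q∈W} λ_U(q)` for every up-set `W` and (N) `Σ_{q∈P, r∈Q} Θ_U(q,r) ≤ Σ_{q∈P∩Q} d(q)` for all up-sets `P, Q`; it proves
`U × [3]^n` good in every dimension (`sStarD_cylSet_nonneg_of_diagCert`).  Every up-set of `[3]^k`, `k ≤ 3`, has one (generation 16, computation).
**THEOREM (`diagCert_literalOneAnd_T`, `diagCert_literalOneAnd_N`, every `k`).**  Let `V ⊆ [3]^k` be an up-set with diagonal certificate `d`, and
`A = {x ∈ [3]^{1+k} : x₀ ≥ 1 ∧ tail x ∈ V}` (the literal `{x₀ ≥ 1}` AND the cylinder over `V`; `glue ξ z ∈ A ↔ 1 ≤ ξ 0 ∧ z ∈ V`).  Then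
   `d'(x) = 0` if `x₀ = 0`,   `d'(x) = 2·d(tail x)` if `x₀ ≥ 1`
is a diagonal certificate of `A` in dimension `1+k`: (T') and (N') hold (and `d' ≥ 0` trivially), so (`sStarD_cylSet_literalOneAnd_nonneg_of_diagCert`)
`A × [3]^n` is a good first slot for every `n`.  PROOF = two short identities (found by the seat's symbolic LP `nest2.py`, instance-checked, then proved here):
  (T')  `λ_A(W') − d'(W') = 2[λ_V(W₁) − d(W₁)] + 2[λ_V(W₂) − d(W₂)] + ν_V(W₁ ∖ W₀) + ν_V(W₂ ∖ W₀)`   (`W_t` = sections of the up-set `W'`),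
  (N')  `d'(B∩C) − Θ_A(B×C) = 2[d(B₁∩C₂) − Θ_V(B₁×C₂)] + 2[d(B₂∩C₁) − Θ_V(B₂×C₁)] + 2Σ_q d(q)(1_{B₂}−1_{B₁})(1_{C₂}−1_{C₁})(q)
          + Σ_q (1_{B₁}−1_{B₀})(q)·K_V(q;C₂) + Σ_q (1_{B₂}−1_{B₀})(q)·K_V(q;C₁) + Σ_r (1_{C₁}−1_{C₀})(r)·K_V(r;B₂) + Σ_r (1_{C₂}−1_{C₀})(r)·K_V(r;B₁)`,
  where `K_V(q;X) = Σ_{r δ̸ q} 1_X(r)(1_V(r) − 1_V(q̄r)) ≥ 0` is Kleitman's inequality in the cube around `q` (`sum_klCoef_ind_nonneg`); every bracket is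
  `≥ 0` by (N), (T), modularity (`d ≥ 0`, nested sections) or Kleitman.  (The (N') identity is proved at the level of totally-distinct pair sums,
  symmetrised in `(q,r)` as in `…CylinderOneAxis`.)
So the class of DIAGONALLY CERTIFIED up-sets — which lifts to every dimension — is closed under the literal-AND step; with the cylinder lift
(`…DiagCertLift`) this is the certificate-level form of the literal step `sStarD_nonneg_literalAnd_of_good` of `…SahiGridPatternLiteralSteps`
(seat memo FROM-prim-sahi-p1-gen28, §3bis: the same LP gives certificate maps for all four literal steps and the cylinder, and NO map for the relative
steps `glue(V⁰,V¹,V¹)`, `glue(V⁰,V⁰,V¹)`).  Nothing here asserts `PatternPos d` for `d ≥ 4`. [this work]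
-/

namespace Summit.CriticalPhenomena.PercolationContinuityZ3.Theorems.SahiGridPattern

open Finset SahiGrid3
open scoped BigOperators

variable {k : ℕ}

/-! ### Local copies of three small lemmas of `…CylinderOneAxis` (private: that module is not yet built on the farm) -/

/-- If two kernels agree after symmetrisation in `(q, r)`, their double sums agree. -/
private theorem sum_sum_eq_of_symm_eq' {α : Type*} [Fintype α] (f g : α → α → ℤ)
    (h : ∀ q r, f q r + f r q = g q r + g r q) :
    (∑ q, ∑ r, f q r) = ∑ q, ∑ r, g q r := by
  have hf : (∑ q, ∑ r, f q r) = ∑ q, ∑ r, f r q := Finset.sum_comm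
  have hg : (∑ q, ∑ r, g q r) = ∑ q, ∑ r, g r q := Finset.sum_comm
  have h2 : (∑ q, ∑ r, (f q r + f r q)) = ∑ q, ∑ r, (g q r + g r q) :=
    Finset.sum_congr rfl fun q _ => Finset.sum_congr rfl fun r _ => h q r
  simp only [Finset.sum_add_distrib] at h2
  omega

/-- `Θ_V(P × Q)` as a totally-distinct pair sum. -/
private theorem sum_sum_thetaVal_eq_pairSum' (V P Q : Finset (Pd k)) :
    (∑ q ∈ P, ∑ r ∈ Q, thetaVal V q r) =
      ∑ q : Pd k, ∑ r : Pd k, (if TotDist q r = true then (1:ℤ) else 0) * (ind P q * ind Q r * (ind V q + ind V r - ind V (thirdPt q r))) := by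
  rw [sum_mem_eq_sum_ind_mul]
  refine Finset.sum_congr rfl fun q _ => ?_
  rw [sum_mem_eq_sum_ind_mul, Finset.mul_sum]
  refine Finset.sum_congr rfl fun r _ => ?_
  unfold thetaVal
  split_ifs <;> ring

/-- Sections of an up-set are nested along the free axis: `s ≤ t`, `glue s q ∈ B` ⟹ `glue t q ∈ B`. -/
private theorem mem_of_glue_mem_of_le' {B : Finset (Pd (1 + k))} (hB : IsUpperSet (B : Set (Pd (1 + k)))) {s t : Fin 3} (hst : s ≤ t)
    {q : Pd k} (h : glue (fun _ : Fin 1 => s) q ∈ B) : glue (fun _ : Fin 1 => t) q ∈ B := by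
  have hle : glue (fun _ : Fin 1 => s) q ≤ glue (fun _ : Fin 1 => t) q := by
    intro a
    refine Fin.addCases (fun i => ?_) (fun j => ?_) a
    · simp only [glue, Fin.append_left]; exact hst
    · simp only [glue, Fin.append_right]; exact le_rfl
  exact hB hle h

/-- Section increments of an up-set are nonnegative: `s ≤ t ⟹ 0 ≤ 1_B(glue t q) − 1_B(glue s q)`. -/
private theorem ind_glue_sub_nonneg {B : Finset (Pd (1 + k))} (hB : IsUpperSet (B : Set (Pd (1 + k)))) {s t : Fin 3} (hst : s ≤ t)
    (q : Pd k) : 0 ≤ ind B (glue (fun _ : Fin 1 => t) q) - ind B (glue (fun _ : Fin 1 => s) q) := by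
  unfold ind
  by_cases h : glue (fun _ : Fin 1 => s) q ∈ B
  · rw [if_pos h, if_pos (mem_of_glue_mem_of_le' hB hst h)]; norm_num
  · rw [if_neg h]; split_ifs <;> norm_num

/-! ### One free axis in front: sums by levels -/

/-- A sum over a finset of `[3]^{1+k}` split along the first axis into the three sections. [this work] -/
theorem sum_mem_eq_levels (W : Finset (Pd (1 + k))) (f : Pd (1 + k) → ℤ) :
    (∑ x ∈ W, f x) = (∑ q : Pd k, ind W (glue (fun _ => 0) q) * f (glue (fun _ => 0) q))
      + (∑ q : Pd k, ind W (glue (fun _ => 1) q) * f (glue (fun _ => 1) q))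
      + (∑ q : Pd k, ind W (glue (fun _ => 2) q) * f (glue (fun _ => 2) q)) := by
  rw [sum_mem_eq_sum_ind_mul, sum_glue, sum_pd1]

/-- `ν` of a set of `[3]^{1+k}` at a glued point, by levels: `ν_A(glue ξ q) = Σ_η [η δ̸ ξ] Σ_r [r δ̸ q] 1_A(glue η r)`. [this work] -/
theorem nuCount_glue_eq (A : Finset (Pd (1 + k))) (ξ : Pd 1) (q : Pd k) :
    (nuCount A (glue ξ q) : ℤ) = ∑ η : Pd 1, (if TotDist η ξ = true then (1:ℤ) else 0) *
      ∑ r : Pd k, ind A (glue η r) * (if TotDist r q = true then (1:ℤ) else 0) := by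
  rw [nuCount_eq_sum_ind, sum_glue]
  refine Finset.sum_congr rfl fun η _ => ?_
  rw [Finset.mul_sum]
  refine Finset.sum_congr rfl fun r _ => ?_
  by_cases h : TotDist (glue η r) (glue ξ q) = true
  · obtain ⟨h1, h2⟩ := (totDist_glue η ξ r q).1 h
    rw [if_pos h, if_pos h1, if_pos h2]; ring
  · rw [if_neg h]
    have : ¬ (TotDist η ξ = true ∧ TotDist r q = true) := fun hh => h ((totDist_glue η ξ r q).2 hh)
    by_cases h1 : TotDist η ξ = true
    · have h2 : ¬ TotDist r q = true := fun h2 => this ⟨h1, h2⟩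
      rw [if_pos h1, if_neg h2]; ring
    · rw [if_neg h1]; ring

variable {V : Finset (Pd k)} {A : Finset (Pd (1 + k))}

/-- Indicator of the literal-AND glued set: `1_A(glue ξ z) = [1 ≤ ξ 0]·1_V(z)`. [this work] -/
theorem ind_glue_literalOneAnd (hA : ∀ ξ z, glue ξ z ∈ A ↔ (1 ≤ ξ 0 ∧ z ∈ V)) (ξ : Pd 1) (z : Pd k) :
    ind A (glue ξ z) = (if 1 ≤ ξ 0 then 1 else 0) * ind V z := by
  unfold ind
  simp only [hA]
  by_cases h1 : 1 ≤ ξ 0 <;> by_cases h2 : z ∈ V <;> simp [h1, h2]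

/-- Level `0` of `A` is empty. [this work] -/
theorem ind_glue_literalOneAnd_zero (hA : ∀ ξ z, glue ξ z ∈ A ↔ (1 ≤ ξ 0 ∧ z ∈ V)) (z : Pd k) :
    ind A (glue (fun _ => 0) z) = 0 := by
  rw [ind_glue_literalOneAnd hA]; simp

/-- Level `1` of `A` is `V`. [this work] -/
theorem ind_glue_literalOneAnd_one (hA : ∀ ξ z, glue ξ z ∈ A ↔ (1 ≤ ξ 0 ∧ z ∈ V)) (z : Pd k) :
    ind A (glue (fun _ => 1) z) = ind V z := by
  rw [ind_glue_literalOneAnd hA]; simp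

/-- Level `2` of `A` is `V`. [this work] -/
theorem ind_glue_literalOneAnd_two (hA : ∀ ξ z, glue ξ z ∈ A ↔ (1 ≤ ξ 0 ∧ z ∈ V)) (z : Pd k) :
    ind A (glue (fun _ => 2) z) = ind V z := by
  rw [ind_glue_literalOneAnd hA]
  simp [show (1:Fin 3) ≤ 2 by decide]

/-- `ν_A` at the three levels: `ν_A(0,q) = 2ν_V(q)`, `ν_A(1,q) = ν_A(2,q) = ν_V(q)` (as pair sums). [this work] -/
theorem nuCount_literalOneAnd_vals (hA : ∀ ξ z, glue ξ z ∈ A ↔ (1 ≤ ξ 0 ∧ z ∈ V)) (q : Pd k) :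
    (nuCount A (glue (fun _ => 0) q) : ℤ) = 2 * ∑ r : Pd k, ind V r * (if TotDist r q = true then (1:ℤ) else 0)
    ∧ (nuCount A (glue (fun _ => 1) q) : ℤ) = ∑ r : Pd k, ind V r * (if TotDist r q = true then (1:ℤ) else 0)
    ∧ (nuCount A (glue (fun _ => 2) q) : ℤ) = ∑ r : Pd k, ind V r * (if TotDist r q = true then (1:ℤ) else 0) := by
  obtain ⟨h00, h11, h22, h01, h02, h10, h12, h20, h21, -, -, -, -, -, -⟩ := pd1_facts
  have i0 := ind_glue_literalOneAnd_zero hA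
  have i1 := ind_glue_literalOneAnd_one hA
  have i2 := ind_glue_literalOneAnd_two hA
  have e : ∀ ξ : Pd 1, (nuCount A (glue ξ q) : ℤ) =
      ((if TotDist (fun _ : Fin 1 => (0:Fin 3)) ξ = true then (1:ℤ) else 0) * 0
        + (if TotDist (fun _ : Fin 1 => (1:Fin 3)) ξ = true then (1:ℤ) else 0) * 1
        + (if TotDist (fun _ : Fin 1 => (2:Fin 3)) ξ = true then (1:ℤ) else 0) * 1)
        * ∑ r : Pd k, ind V r * (if TotDist r q = true then (1:ℤ) else 0) := by
    intro ξ
    rw [nuCount_glue_eq, sum_pd1]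
    simp only [i0, i1, i2, zero_mul, Finset.sum_const_zero]
    ring
  refine ⟨?_, ?_, ?_⟩
  · rw [e]; simp only [h00, h10, h20]; norm_num
  · rw [e]; simp only [h01, h11, h21]; norm_num
  · rw [e]; simp only [h02, h12, h22]; norm_num

/-! ### (T') -/

/-- **(T') for the literal-AND step**: if `d` satisfies (T) for `V`, then `d' = (0, 2d, 2d)` satisfies (T) for `A = {x₀ ≥ 1} ∧ V`:
`Σ_{x∈W'} d'(x) ≤ Σ_{x∈W'} λ_A(x)` for every up-set `W' ⊆ [3]^{1+k}`. [this work] -/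
theorem diagCert_literalOneAnd_T (hA : ∀ ξ z, glue ξ z ∈ A ↔ (1 ≤ ξ 0 ∧ z ∈ V)) (d : Pd k → ℤ)
    (hT : ∀ W : Finset (Pd k), IsUpperSet (W : Set (Pd k)) → (∑ q ∈ W, d q) ≤ ∑ q ∈ W, lamU V q)
    (W' : Finset (Pd (1 + k))) (hW' : IsUpperSet (W' : Set (Pd (1 + k)))) :
    (∑ x ∈ W', (fun x => if freeOf x 0 = 0 then (0:ℤ) else 2 * d (cellOf x)) x) ≤ ∑ x ∈ W', lamU A x := by
  have i0 := ind_glue_literalOneAnd_zero hA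
  have i1 := ind_glue_literalOneAnd_one hA
  have i2 := ind_glue_literalOneAnd_two hA
  have hν := nuCount_literalOneAnd_vals hA
  -- the two sides by levels
  rw [sum_mem_eq_levels W' _, sum_mem_eq_levels W' (lamU A)]
  simp only [freeOf_glue, cellOf_glue]
  have hl : ∀ q : Pd k, lamU A (glue (fun _ => 0) q) = - 2 * ∑ r : Pd k, ind V r * (if TotDist r q = true then (1:ℤ) else 0)
      ∧ lamU A (glue (fun _ => 1) q) = 2 * 2 ^ (1 + k) * ind V q - ∑ r : Pd k, ind V r * (if TotDist r q = true then (1:ℤ) else 0)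
      ∧ lamU A (glue (fun _ => 2) q) = 2 * 2 ^ (1 + k) * ind V q - ∑ r : Pd k, ind V r * (if TotDist r q = true then (1:ℤ) else 0) := by
    intro q
    obtain ⟨n0, n1, n2⟩ := hν q
    unfold lamU
    rw [n0, n1, n2, i0, i1, i2]
    refine ⟨by ring, by ring, by ring⟩
  -- (T) for V at the sections W₁, W₂
  have hT1 := hT (sect W' (fun _ => 1)) (isUpperSet_sect hW' _)
  have hT2 := hT (sect W' (fun _ => 2)) (isUpperSet_sect hW' _)
  rw [sum_mem_eq_sum_ind_mul, sum_mem_eq_sum_ind_mul (sect W' _) (lamU V)] at hT1 hT2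
  simp only [ind_sect] at hT1 hT2
  -- λ_V(q) = 2·2^k 1_V(q) − ν_V(q)
  have hlamV : ∀ q : Pd k, lamU V q = 2 * 2 ^ k * ind V q - ∑ r : Pd k, ind V r * (if TotDist r q = true then (1:ℤ) else 0) := by
    intro q; unfold lamU; rw [nuCount_eq_sum_ind]
  -- nestedness of the sections of W'
  have hn01 : ∀ q : Pd k, ind W' (glue (fun _ => 0) q) ≤ ind W' (glue (fun _ => 1) q) := fun q => by
    have := ind_glue_sub_nonneg hW' (show (0:Fin 3) ≤ 1 by decide) q; linarith
  have hn02 : ∀ q : Pd k, ind W' (glue (fun _ => 0) q) ≤ ind W' (glue (fun _ => 2) q) := fun q => by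
    have := ind_glue_sub_nonneg hW' (show (0:Fin 3) ≤ 2 by decide) q; linarith
  have hνnn : ∀ q : Pd k, 0 ≤ ∑ r : Pd k, ind V r * (if TotDist r q = true then (1:ℤ) else 0) :=
    fun q => Finset.sum_nonneg fun r _ => mul_nonneg (ind_nonneg' V r) (by split_ifs <;> norm_num)
  -- assemble
  have e0 : (∑ q : Pd k, ind W' (glue (fun _ => 0) q) * lamU A (glue (fun _ => 0) q))
      = ∑ q : Pd k, ind W' (glue (fun _ => 0) q) * (- 2 * ∑ r : Pd k, ind V r * (if TotDist r q = true then (1:ℤ) else 0)) :=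
    Finset.sum_congr rfl fun q _ => by rw [(hl q).1]
  have e1 : (∑ q : Pd k, ind W' (glue (fun _ => 1) q) * lamU A (glue (fun _ => 1) q))
      = ∑ q : Pd k, ind W' (glue (fun _ => 1) q) * (2 * lamU V q + ∑ r : Pd k, ind V r * (if TotDist r q = true then (1:ℤ) else 0)) :=
    Finset.sum_congr rfl fun q _ => by rw [(hl q).2.1, hlamV q]; ring
  have e2 : (∑ q : Pd k, ind W' (glue (fun _ => 2) q) * lamU A (glue (fun _ => 2) q))
      = ∑ q : Pd k, ind W' (glue (fun _ => 2) q) * (2 * lamU V q + ∑ r : Pd k, ind V r * (if TotDist r q = true then (1:ℤ) else 0)) :=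
    Finset.sum_congr rfl fun q _ => by rw [(hl q).2.2, hlamV q]; ring
  rw [e0, e1, e2]
  simp only [show ¬ ((1:Fin 3) = 0) by decide, show ¬ ((2:Fin 3) = 0) by decide, if_false, if_true, mul_zero,
    Finset.sum_const_zero, zero_add]
  have s1 : (∑ q : Pd k, ind W' (glue (fun _ => 1) q) * (2 * d q)) = 2 * ∑ q : Pd k, ind W' (glue (fun _ => 1) q) * d q := by
    rw [Finset.mul_sum]; refine Finset.sum_congr rfl fun q _ => ?_; ring
  have s2 : (∑ q : Pd k, ind W' (glue (fun _ => 2) q) * (2 * d q)) = 2 * ∑ q : Pd k, ind W' (glue (fun _ => 2) q) * d q := by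
    rw [Finset.mul_sum]; refine Finset.sum_congr rfl fun q _ => ?_; ring
  rw [s1, s2]
  -- the slack: 2(λ_V−d)(W₁) + 2(λ_V−d)(W₂) + ν_V(W₁−W₀) + ν_V(W₂−W₀) ≥ 0
  have split1 : (∑ q : Pd k, ind W' (glue (fun _ => 1) q) * (2 * lamU V q + ∑ r : Pd k, ind V r * (if TotDist r q = true then (1:ℤ) else 0)))
      = 2 * (∑ q : Pd k, ind W' (glue (fun _ => 1) q) * lamU V q)
        + ∑ q : Pd k, ind W' (glue (fun _ => 1) q) * ∑ r : Pd k, ind V r * (if TotDist r q = true then (1:ℤ) else 0) := by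
    rw [Finset.mul_sum, ← Finset.sum_add_distrib]; refine Finset.sum_congr rfl fun q _ => ?_; ring
  have split2 : (∑ q : Pd k, ind W' (glue (fun _ => 2) q) * (2 * lamU V q + ∑ r : Pd k, ind V r * (if TotDist r q = true then (1:ℤ) else 0)))
      = 2 * (∑ q : Pd k, ind W' (glue (fun _ => 2) q) * lamU V q)
        + ∑ q : Pd k, ind W' (glue (fun _ => 2) q) * ∑ r : Pd k, ind V r * (if TotDist r q = true then (1:ℤ) else 0) := by
    rw [Finset.mul_sum, ← Finset.sum_add_distrib]; refine Finset.sum_congr rfl fun q _ => ?_; ring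
  rw [split1, split2]
  have k0 : (∑ q : Pd k, ind W' (glue (fun _ => 0) q) * (-2 * ∑ r : Pd k, ind V r * (if TotDist r q = true then (1:ℤ) else 0)))
      ≥ - (∑ q : Pd k, ind W' (glue (fun _ => 1) q) * ∑ r : Pd k, ind V r * (if TotDist r q = true then (1:ℤ) else 0))
        - (∑ q : Pd k, ind W' (glue (fun _ => 2) q) * ∑ r : Pd k, ind V r * (if TotDist r q = true then (1:ℤ) else 0)) := by
    rw [ge_iff_le, sub_eq_add_neg, ← Finset.sum_neg_distrib, ← Finset.sum_neg_distrib, ← Finset.sum_add_distrib]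
    refine Finset.sum_le_sum fun q _ => ?_
    have := hn01 q; have := hn02 q; have := hνnn q
    nlinarith
  linarith

/-! ### (N') -/

/-- Kleitman in the cube around `q`, pair-sum form with the seat's orientation: `0 ≤ Σ_r [q δ̸ r]·1_X(r)(1_V(r) − 1_V(q̄r))`. [this work] -/
theorem kleitman_pair_nonneg (hV : IsUpperSet (V : Set (Pd k))) {X : Finset (Pd k)} (hX : IsUpperSet (X : Set (Pd k))) (q : Pd k) :
    0 ≤ ∑ r : Pd k, (if TotDist q r = true then (1:ℤ) else 0) * (ind X r * (ind V r - ind V (thirdPt q r))) := by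
  have h := sum_klCoef_ind_nonneg hV hX q
  have e : (∑ r : Pd k, klCoef V q r * ind X r)
      = ∑ r : Pd k, (if TotDist q r = true then (1:ℤ) else 0) * (ind X r * (ind V r - ind V (thirdPt q r))) := by
    refine Finset.sum_congr rfl fun r _ => ?_
    unfold klCoef
    rw [totDist_symm r q, thirdPt_comm r q]
    split_ifs <;> ring
  rw [e] at h; exact h

/-- Weighted Kleitman: `0 ≤ Σ_q f(q) Σ_r [q δ̸ r] 1_X(r)(1_V(r) − 1_V(q̄r))` for a pointwise nonnegative weight `f`. [this work] -/
theorem weighted_kleitman_nonneg (hV : IsUpperSet (V : Set (Pd k))) {X : Finset (Pd k)} (hX : IsUpperSet (X : Set (Pd k)))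
    (f : Pd k → ℤ) (hf : ∀ q, 0 ≤ f q) :
    0 ≤ ∑ q : Pd k, ∑ r : Pd k, (if TotDist q r = true then (1:ℤ) else 0) * (f q * (ind X r * (ind V r - ind V (thirdPt q r)))) := by
  refine Finset.sum_nonneg fun q _ => ?_
  have e : (∑ r : Pd k, (if TotDist q r = true then (1:ℤ) else 0) * (f q * (ind X r * (ind V r - ind V (thirdPt q r)))))
      = f q * ∑ r : Pd k, (if TotDist q r = true then (1:ℤ) else 0) * (ind X r * (ind V r - ind V (thirdPt q r))) := by
    rw [Finset.mul_sum]; refine Finset.sum_congr rfl fun r _ => ?_; ring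
  rw [e]; exact mul_nonneg (hf q) (kleitman_pair_nonneg hV hX q)

/-- A single sum as a totally-distinct pair sum: `2^k · Σ_q g(q) = Σ_q Σ_r [q δ̸ r] g(q)`. [this work] -/
theorem two_pow_mul_sum_eq_pairSum (g : Pd k → ℤ) :
    2 ^ k * (∑ q : Pd k, g q) = ∑ q : Pd k, ∑ r : Pd k, (if TotDist q r = true then (1:ℤ) else 0) * g q := by
  rw [Finset.mul_sum]
  refine Finset.sum_congr rfl fun q _ => ?_
  rw [← Finset.sum_mul, sum_ite_totDist_eq_two_pow]

/-- **(N') for the literal-AND step**: if `d ≥ 0` satisfies (N) for the up-set `V`, then `d' = (0, 2d, 2d)` satisfies (N) for `A = {x₀ ≥ 1} ∧ V`: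
`Σ_{x∈B, y∈C} Θ_A(x,y) ≤ Σ_{x∈B∩C} d'(x)` for all up-sets `B, C ⊆ [3]^{1+k}`. [this work] -/
theorem diagCert_literalOneAnd_N (hV : IsUpperSet (V : Set (Pd k))) (hA : ∀ ξ z, glue ξ z ∈ A ↔ (1 ≤ ξ 0 ∧ z ∈ V)) (d : Pd k → ℤ)
    (hd : ∀ q, 0 ≤ d q)
    (hN : ∀ P Q : Finset (Pd k), IsUpperSet (P : Set (Pd k)) → IsUpperSet (Q : Set (Pd k)) →
      (∑ q ∈ P, ∑ r ∈ Q, thetaVal V q r) ≤ ∑ q ∈ P ∩ Q, d q)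
    (B C : Finset (Pd (1 + k))) (hB : IsUpperSet (B : Set (Pd (1 + k)))) (hC : IsUpperSet (C : Set (Pd (1 + k)))) :
    (∑ x ∈ B, ∑ y ∈ C, thetaVal A x y) ≤ ∑ x ∈ B ∩ C, (fun x => if freeOf x 0 = 0 then (0:ℤ) else 2 * d (cellOf x)) x := by
  have i0 := ind_glue_literalOneAnd_zero hA
  have i1 := ind_glue_literalOneAnd_one hA
  have i2 := ind_glue_literalOneAnd_two hA
  have hν := nuCount_literalOneAnd_vals hA
  -- Θ_A-sum = λ_A(B∩C) − sStarD A B C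
  have eS := sStarD_eq_sum_lamU_sub_sum_thetaVal A B C
  -- the goal follows from:  Σ_{B∩C} λ_A − Σ_{B∩C} d' ≤ sStarD A B C
  suffices key : (∑ x ∈ B ∩ C, lamU A x) - (∑ x ∈ B ∩ C, (fun x => if freeOf x 0 = 0 then (0:ℤ) else 2 * d (cellOf x)) x) ≤ sStarD A B C by
    linarith
  -- abbreviations for the sections (as indicator functions)
  -- level decomposition of the two single sums
  have hl : ∀ q : Pd k, lamU A (glue (fun _ => 0) q) = - 2 * ∑ r : Pd k, ind V r * (if TotDist r q = true then (1:ℤ) else 0)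
      ∧ lamU A (glue (fun _ => 1) q) = 2 * 2 ^ (1 + k) * ind V q - ∑ r : Pd k, ind V r * (if TotDist r q = true then (1:ℤ) else 0)
      ∧ lamU A (glue (fun _ => 2) q) = 2 * 2 ^ (1 + k) * ind V q - ∑ r : Pd k, ind V r * (if TotDist r q = true then (1:ℤ) else 0) := by
    intro q
    obtain ⟨n0, n1, n2⟩ := hν q
    unfold lamU
    rw [n0, n1, n2, i0, i1, i2]
    refine ⟨by ring, by ring, by ring⟩
  have L1 : (∑ x ∈ B ∩ C, lamU A x)
      = ∑ q : Pd k, ∑ r : Pd k, (if TotDist q r = true then (1:ℤ) else 0) *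
          ( ind B (glue (fun _ => 0) q) * ind C (glue (fun _ => 0) q) * (- 2 * ind V r)
          + ind B (glue (fun _ => 1) q) * ind C (glue (fun _ => 1) q) * (4 * ind V q - ind V r)
          + ind B (glue (fun _ => 2) q) * ind C (glue (fun _ => 2) q) * (4 * ind V q - ind V r) ) := by
    rw [sum_mem_eq_levels]
    simp only [ind_inter_eq_mul]
    have c4 : ∀ q : Pd k, (2:ℤ) * 2 ^ (1 + k) * ind V q = ∑ r : Pd k, (if TotDist q r = true then (1:ℤ) else 0) * (4 * ind V q) := by
      intro q; rw [← Finset.sum_mul, sum_ite_totDist_eq_two_pow]; ring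
    have cν : ∀ q : Pd k, (∑ r : Pd k, ind V r * (if TotDist r q = true then (1:ℤ) else 0))
        = ∑ r : Pd k, (if TotDist q r = true then (1:ℤ) else 0) * ind V r := by
      intro q; refine Finset.sum_congr rfl fun r _ => ?_; rw [totDist_symm r q]; ring
    rw [← Finset.sum_add_distrib, ← Finset.sum_add_distrib]
    refine Finset.sum_congr rfl fun q _ => ?_
    rw [(hl q).1, (hl q).2.1, (hl q).2.2, c4 q, cν q]
    simp only [Finset.mul_sum, ← Finset.sum_sub_distrib, ← Finset.sum_add_distrib]
    refine Finset.sum_congr rfl fun r _ => ?_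
    ring
  have L2 : (∑ x ∈ B ∩ C, (fun x => if freeOf x 0 = 0 then (0:ℤ) else 2 * d (cellOf x)) x)
      = 2 * ∑ q : Pd k, (ind B (glue (fun _ => 1) q) * ind C (glue (fun _ => 1) q) + ind B (glue (fun _ => 2) q) * ind C (glue (fun _ => 2) q)) * d q := by
    rw [sum_mem_eq_levels]
    simp only [ind_inter_eq_mul, freeOf_glue, cellOf_glue, show ¬ ((1:Fin 3) = 0) by decide, show ¬ ((2:Fin 3) = 0) by decide,
      if_false, if_true, mul_zero, Finset.sum_const_zero, zero_add]
    rw [Finset.mul_sum, ← Finset.sum_add_distrib]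
    refine Finset.sum_congr rfl fun q _ => ?_; ring
  -- the pattern functional of A, one axis explicit, with the sections of A substituted
  have L3 := sStarD_eq_pd1_sections A B C
  simp only [i0, i1, i2] at L3
  -- hypotheses (N) at the cross section pairs (B₁,C₂) and (B₂,C₁), in pair-sum form
  have hN12 := hN (sect B (fun _ => 1)) (sect C (fun _ => 2)) (isUpperSet_sect hB _) (isUpperSet_sect hC _)
  have hN21 := hN (sect B (fun _ => 2)) (sect C (fun _ => 1)) (isUpperSet_sect hB _) (isUpperSet_sect hC _)
  rw [sum_sum_thetaVal_eq_pairSum', sum_mem_eq_sum_ind_mul (sect B _ ∩ sect C _)] at hN12 hN21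
  simp only [ind_inter_eq_mul, ind_sect] at hN12 hN21
  -- Kleitman terms (weights = nonneg section increments)
  have hB01 := fun q => ind_glue_sub_nonneg hB (show (0:Fin 3) ≤ 1 by decide) q
  have hB02 := fun q => ind_glue_sub_nonneg hB (show (0:Fin 3) ≤ 2 by decide) q
  have hC01 := fun q => ind_glue_sub_nonneg hC (show (0:Fin 3) ≤ 1 by decide) q
  have hC02 := fun q => ind_glue_sub_nonneg hC (show (0:Fin 3) ≤ 2 by decide) q
  have hB12 := fun q => ind_glue_sub_nonneg hB (show (1:Fin 3) ≤ 2 by decide) q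
  have hC12 := fun q => ind_glue_sub_nonneg hC (show (1:Fin 3) ≤ 2 by decide) q
  have K1 := weighted_kleitman_nonneg hV (isUpperSet_sect hC (fun _ => 2)) _ hB01
  have K2 := weighted_kleitman_nonneg hV (isUpperSet_sect hC (fun _ => 1)) _ hB02
  have K3 := weighted_kleitman_nonneg hV (isUpperSet_sect hB (fun _ => 2)) _ hC01
  have K4 := weighted_kleitman_nonneg hV (isUpperSet_sect hB (fun _ => 1)) _ hC02
  simp only [ind_sect] at K1 K2 K3 K4
  -- modularity: d(W₁₁) + d(W₂₂) − d(W₁₂) − d(W₂₁) = Σ d (1_{B₂}−1_{B₁})(1_{C₂}−1_{C₁}) ≥ 0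
  have M : 0 ≤ ∑ q : Pd k, d q * ((ind B (glue (fun _ => 2) q) - ind B (glue (fun _ => 1) q)) * (ind C (glue (fun _ => 2) q) - ind C (glue (fun _ => 1) q))) :=
    Finset.sum_nonneg fun q _ => mul_nonneg (hd q) (mul_nonneg (hB12 q) (hC12 q))
  -- the d-part identity (single sums)
  have Dpart : 2 * (∑ q : Pd k, (ind B (glue (fun _ => 1) q) * ind C (glue (fun _ => 1) q) + ind B (glue (fun _ => 2) q) * ind C (glue (fun _ => 2) q)) * d q)
      = 2 * (∑ q : Pd k, ind B (glue (fun _ => 1) q) * ind C (glue (fun _ => 2) q) * d q)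
        + 2 * (∑ q : Pd k, ind B (glue (fun _ => 2) q) * ind C (glue (fun _ => 1) q) * d q)
        + 2 * (∑ q : Pd k, d q * ((ind B (glue (fun _ => 2) q) - ind B (glue (fun _ => 1) q)) * (ind C (glue (fun _ => 2) q) - ind C (glue (fun _ => 1) q)))) := by
    simp only [Finset.mul_sum, ← Finset.sum_add_distrib]
    refine Finset.sum_congr rfl fun q _ => ?_; ring
  -- the pair-sum identity (symmetrised in (q,r)):  sStarD − (Σλ_A − levels) + 2Θ_V(B₁×C₂) + 2Θ_V(B₂×C₁) = the four Kleitman sums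
  have PairId : sStarD A B C
      - (∑ q : Pd k, ∑ r : Pd k, (if TotDist q r = true then (1:ℤ) else 0) *
          ( ind B (glue (fun _ => 0) q) * ind C (glue (fun _ => 0) q) * (- 2 * ind V r)
          + ind B (glue (fun _ => 1) q) * ind C (glue (fun _ => 1) q) * (4 * ind V q - ind V r)
          + ind B (glue (fun _ => 2) q) * ind C (glue (fun _ => 2) q) * (4 * ind V q - ind V r) ))
      + 2 * (∑ q : Pd k, ∑ r : Pd k, (if TotDist q r = true then (1:ℤ) else 0) *
          (ind B (glue (fun _ => 1) q) * ind C (glue (fun _ => 2) r) * (ind V q + ind V r - ind V (thirdPt q r))))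
      + 2 * (∑ q : Pd k, ∑ r : Pd k, (if TotDist q r = true then (1:ℤ) else 0) *
          (ind B (glue (fun _ => 2) q) * ind C (glue (fun _ => 1) r) * (ind V q + ind V r - ind V (thirdPt q r))))
      = (∑ q : Pd k, ∑ r : Pd k, (if TotDist q r = true then (1:ℤ) else 0) *
          ((ind B (glue (fun _ => 1) q) - ind B (glue (fun _ => 0) q)) * (ind C (glue (fun _ => 2) r) * (ind V r - ind V (thirdPt q r)))))
      + (∑ q : Pd k, ∑ r : Pd k, (if TotDist q r = true then (1:ℤ) else 0) *
          ((ind B (glue (fun _ => 2) q) - ind B (glue (fun _ => 0) q)) * (ind C (glue (fun _ => 1) r) * (ind V r - ind V (thirdPt q r)))))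
      + (∑ q : Pd k, ∑ r : Pd k, (if TotDist q r = true then (1:ℤ) else 0) *
          ((ind C (glue (fun _ => 1) q) - ind C (glue (fun _ => 0) q)) * (ind B (glue (fun _ => 2) r) * (ind V r - ind V (thirdPt q r)))))
      + (∑ q : Pd k, ∑ r : Pd k, (if TotDist q r = true then (1:ℤ) else 0) *
          ((ind C (glue (fun _ => 2) q) - ind C (glue (fun _ => 0) q)) * (ind B (glue (fun _ => 1) r) * (ind V r - ind V (thirdPt q r))))) := by
    rw [L3]
    simp only [Finset.mul_sum, ← Finset.sum_add_distrib, ← Finset.sum_sub_distrib]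
    refine sum_sum_eq_of_symm_eq' _ _ fun q r => ?_
    rw [totDist_symm r q, thirdPt_comm r q]
    split_ifs <;> ring
  rw [L1, L2, Dpart]
  linarith [PairId, K1, K2, K3, K4, M, hN12, hN21]

/-- **THE LITERAL-AND STEP PRESERVES DIAGONAL CERTIFIABILITY, hence goodness in EVERY dimension**: if the up-set `V ⊆ [3]^k` has a
diagonal certificate `d` and `A = {x₀ ≥ 1} ∧ V ⊆ [3]^{1+k}`, then `A × [3]^n` is a good first slot for all `n`. [this work] -/
theorem sStarD_cylSet_literalOneAnd_nonneg_of_diagCert (hV : IsUpperSet (V : Set (Pd k))) (hA : ∀ ξ z, glue ξ z ∈ A ↔ (1 ≤ ξ 0 ∧ z ∈ V))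
    (d : Pd k → ℤ) (hd : ∀ q, 0 ≤ d q)
    (hT : ∀ W : Finset (Pd k), IsUpperSet (W : Set (Pd k)) → (∑ q ∈ W, d q) ≤ ∑ q ∈ W, lamU V q)
    (hN : ∀ P Q : Finset (Pd k), IsUpperSet (P : Set (Pd k)) → IsUpperSet (Q : Set (Pd k)) →
      (∑ q ∈ P, ∑ r ∈ Q, thetaVal V q r) ≤ ∑ q ∈ P ∩ Q, d q)
    {n : ℕ} {B C : Finset (Pd (n + (1 + k)))} (hB : IsUpperSet (B : Set (Pd (n + (1 + k))))) (hC : IsUpperSet (C : Set (Pd (n + (1 + k))))) :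
    0 ≤ sStarD (cylSet A : Finset (Pd (n + (1 + k)))) B C :=
  sStarD_cylSet_nonneg_of_diagCert A (fun x => if freeOf x 0 = 0 then (0:ℤ) else 2 * d (cellOf x))
    (fun x => by
      show 0 ≤ (if freeOf x 0 = 0 then (0:ℤ) else 2 * d (cellOf x))
      split_ifs
      · exact le_rfl
      · exact mul_nonneg (by norm_num) (hd _))
    (fun W' hW' => diagCert_literalOneAnd_T hA d hT W' hW')
    (fun P Q hP hQ => diagCert_literalOneAnd_N hV hA d hd hN P Q hP hQ) hB hC

end Summit.CriticalPhenomena.PercolationContinuityZ3.Theorems.SahiGridPattern
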